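import Mathlib.RingTheory.Derivation.Basic
import Mathlib.RingTheory.AlgebraicIndependent.Basic
import Mathlib.LinearAlgebra.Matrix.Rank
import Mathlib.Algebra.CharZero.Defs
import HarnessLib

/-!
# Ax's theorem (Ax–Schanuel), differential-field form

Trunk T-TRANSCEND (Literature/NumberTheory/Transcendental); cite/fact item `wi-03400`
(route Schanuel/EclCore): Ax 1971, Theorem 3, the functional (differential) analogue of
Schanuel's conjecture, vendored as a named fact.

**Ax 1971, Thm. 3.** Let `K` be a field of characteristic `0`, `Δ` a set of derivations of `K`,
`C = ⋂_{D ∈ Δ} ker D` its field of constants. Let `y₁, …, yₙ ∈ K` and `z₁, …, zₙ ∈ Kˣ` satisfy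
`D zᵢ = zᵢ · D yᵢ` for all `D ∈ Δ` ("`zᵢ = e^{yᵢ}`"), and suppose `y₁, …, yₙ` are `ℚ`-linearly
independent modulo `C`. Then
`trdeg_C C(y₁, …, yₙ, z₁, …, zₙ) ≥ n + rank (D yᵢ)_{i, D}`.
The power-series form (`yᵢ ∈ t·ℂ⟦t₁,…,t_m⟧`, `Δ = {∂/∂tⱼ}`, `C = ℂ`) is the special case that gives
the item's first formulation.

## Contents

* `constantSubring D` — the common kernel `C` of a family of derivations `D j : K → K` as a
  subring (a subfield when `K` is a field: kernels of derivations are closed under inverses).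
* `IsQLinearIndependentMod D y` — `ℚ`-linear independence of `y₁, …, yₙ` modulo `C`
  (integer coefficients; equivalent over a field of characteristic `0`).
* `ax_schanuel : Prop` — the named fact, transcendence degree as Mathlib's `Algebra.trdeg` of the
  `C`-subalgebra generated by the `yᵢ, zᵢ` (equal to that of the field they generate).

## Design choices

* Finitely many derivations `D : Fin m → Derivation ℤ K K` (Ax allows any set; only the finitely
  many values `D yᵢ` enter the rank, and the constants only shrink with more derivations — the
  finite-family form is what routes use; recorded deviation).
* Derivations over `ℤ` (`Derivation ℤ K K`) = additive Leibniz maps, i.e. plain derivations of the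
  ring `K`, as in Mathlib's `Differential`.
* Mathlib: `Derivation`, `Algebra.trdeg`, `Algebra.adjoin`, `Matrix.rank`; Mathlib has no
  Ax–Schanuel and no "field of constants of a family of derivations" (`Differential` fixes one
  derivation and phrases constants via `ContainConstants`).
-/

noncomputable section

namespace Literature.NumberTheory.Transcendental

/-! ### Constants of a family of derivations -/

section Constants

variable {K : Type*} [CommRing K] {ι : Type*}

/-- The ring of common constants `C = {x | ∀ j, D j x = 0}` of a family of derivations of `K`.
[Ax 1971, §1 (field of constants `C = ⋂ ker D`)] [cite: Ax1971, Thm. 3] -/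
def constantSubring (D : ι → Derivation ℤ K K) : Subring K where
  carrier := {x | ∀ j, D j x = 0}
  mul_mem' {a b} ha hb := fun j => by simp [Derivation.leibniz, ha j, hb j]
  one_mem' := fun j => Derivation.map_one_eq_zero _
  add_mem' {a b} ha hb := fun j => by simp [map_add, ha j, hb j]
  zero_mem' := fun j => map_zero _
  neg_mem' {a} ha := fun j => by simp [map_neg, ha j]

/-- Membership in the constants: all derivations vanish. [Ax 1971, §1] [folklore] -/
@[simp] theorem mem_constantSubring {D : ι → Derivation ℤ K K} {x : K} :
    x ∈ constantSubring D ↔ ∀ j, D j x = 0 :=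
  Iff.rfl

/-- Over a field, the constants are closed under inverses (`D(x⁻¹) = -x⁻² D x`), so `C` is a
subfield. [Ax 1971, §1] [folklore] -/
theorem inv_mem_constantSubring {F : Type*} [Field F] {D : ι → Derivation ℤ F F} {x : F}
    (hx : x ∈ constantSubring D) : x⁻¹ ∈ constantSubring D := by
  intro j
  rcases eq_or_ne x 0 with rfl | hx0
  · simp
  · have h : D j (x * x⁻¹) = 0 := by rw [mul_inv_cancel₀ hx0]; exact Derivation.map_one_eq_zero _
    rw [Derivation.leibniz, hx j, smul_zero, add_zero, smul_eq_mul] at h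
    exact (mul_eq_zero.1 h).resolve_left hx0

/-- `y₁, …, yₙ` are `ℚ`-linearly independent modulo the constants `C`: an integer combination
`∑ qᵢ yᵢ` lies in `C` only if all `qᵢ = 0` (over a field of characteristic `0` this is
`ℚ`-linear independence of the classes `yᵢ + C` in `K/C`). [Ax 1971, Thm. 3 (hypothesis)] [cite: Ax1971, Thm. 3] -/
def IsQLinearIndependentMod (D : ι → Derivation ℤ K K) {n : ℕ} (y : Fin n → K) : Prop :=
  ∀ q : Fin n → ℤ, (∑ i, (q i : K) * y i) ∈ constantSubring D → q = 0

end Constants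

/-! ### The named fact -/

/-- **Ax's theorem (Ax–Schanuel, differential form).** For a field `K` of characteristic `0` with
derivations `D₁, …, D_m`, constants `C = ⋂ ker Dⱼ`, and `y, z : Fin n → K` with `zᵢ ≠ 0`,
`Dⱼ zᵢ = zᵢ Dⱼ yᵢ` for all `i, j`, and `y₁, …, yₙ` `ℚ`-linearly independent modulo `C`:
`n + rank (Dⱼ yᵢ)ᵢⱼ ≤ trdeg_C C[y, z]` (transcendence degree over `C` of the algebra — equivalently
the field — generated by the `yᵢ, zᵢ`). In particular (one derivation, some `D yᵢ ≠ 0`)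
`trdeg ≥ n + 1`. [Ax 1971, Thm. 3 (and Cor. 1 for the one-derivation case)] [cite: Ax1971, Thm. 3] -/
def ax_schanuel : Prop :=
  ∀ (K : Type) [Field K] [CharZero K] (m n : ℕ) (D : Fin m → Derivation ℤ K K) (y z : Fin n → K),
    (∀ i, z i ≠ 0) → (∀ j i, D j (z i) = z i * D j (y i)) → IsQLinearIndependentMod D y →
      ((n + (Matrix.of fun i j => D j (y i)).rank : ℕ) : Cardinal) ≤
        Algebra.trdeg (constantSubring D)
          (Algebra.adjoin (constantSubring D) (Set.range y ∪ Set.range z))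

/-! ### API -/

/-- The empty family is vacuously independent modulo constants. [folklore] -/
theorem isQLinearIndependentMod_zero {K : Type*} [CommRing K] {ι : Type*}
    (D : ι → Derivation ℤ K K) (y : Fin 0 → K) : IsQLinearIndependentMod D y :=
  fun _ _ => funext fun i => i.elim0

/-- Constants themselves are never part of an independent family: if some `yᵢ ∈ C` then `y` is not
`ℚ`-linearly independent modulo `C`. [Ax 1971, Thm. 3 (necessity of the hypothesis)] [folklore] -/
theorem not_isQLinearIndependentMod_of_mem {K : Type*} [CommRing K] {ι : Type*}
    {D : ι → Derivation ℤ K K} {n : ℕ} {y : Fin n → K} {i₀ : Fin n}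
    (h : y i₀ ∈ constantSubring D) : ¬ IsQLinearIndependentMod D y := by
  intro hind
  have hq := hind (Pi.single i₀ 1) (by
    have : (∑ i, ((Pi.single i₀ (1 : ℤ) : Fin n → ℤ) i : K) * y i) = y i₀ := by
      rw [Finset.sum_eq_single i₀]
      · simp
      · intro b _ hb; simp [hb]
      · intro h; exact absurd (Finset.mem_univ i₀) h
    rw [this]; exact h)
  have := congrFun hq i₀
  simp at this

end Literature.NumberTheory.Transcendental
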